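/-
Copyright (c) 2026. All rights reserved.
Released under Apache 2.0 license as described in the file LICENSE.
Authors: abc-iut cell, wave-W6 seat abc-iut-w6-d074 (row THM26II-SIGMA-STAR, abc-iut-L4-lead RULING #7j).
-/
import Mathlib.NumberTheory.Padics.ProperSpace
import Mathlib.Analysis.SpecificLimits.Basic
import Literature.AnabelianGeometry.AbsoluteAnabelian.AbsAnabFundamentalGroups
import HarnessLib

/-!
# [AbsTopI] Thm 2.6 (ii) for a general prime set `Σ`: the model `Ẑ_Σ^m` and condition (∗)_Σ

S. Mochizuki, *Topics in Absolute Anabelian Geometry I: Generalities* (2012) [AbsTopI], Thm 2.6 (ii),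
manuscript p. 21 (lit key `paper:url-11ac98ba15fc`), and its proof p. 22 l. 36 – p. 23 l. 20 (render
`HOME/lit/renders/AbsTopI-kurims-url-11ac98ba15fc/p0022.txt`, `p0023.txt`):

  "Note, moreover, that for `l ∈ Σ`, the quotient of `Δ` determined by the image of `Δ` in the pro-`l`
   completion of `Π^{ab-t}` factors through the quotient `Δ ↠ Δ^{ab-t} ⊗ ℤ_l ⥲ T_l(A) ↠ T_l(A)/G` —
   where we use the notation "`/G`" to denote the maximal torsion-free quotient on which `G` acts
   trivially. […] `Q_l := Q ⊗ ℤ_l` […] Thus, the `ℤ_l`-ranks of `R_l`, `Q_l` are independent of `l ∈ Σ`.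
   […] `δ¹_l(Π) = δ¹_l(G) + dim_{ℚ_l}(Q_l ⊗ ℚ_l)` [where we recall that `dim_{ℚ_l}(Q_l ⊗ ℚ_l)` is
   independent of `l`] for `l ∈ Σ`, `δ¹_l(Π) = δ¹_l(G)` for `l ∉ Σ`."

The tree types the corresponding input of S. Mochizuki, *The Absolute Anabelian Geometry of Hyperbolic
Curves* (2004) [AbsAnab], Lemma 1.1.4 (ii) — condition (∗): "the maximal torsion-free quotient
`(Δ″)^{ab} ↠ Q″` on which `G″` acts trivially is a finitely generated free `Ẑ`-module" — as
abc-iut-L4-t4's `FundamentalExtension.StarCondition` (`Δ″/R ≅ Ẑ^m`, `R = coinvRadical Π″`), which is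
the case `Σ = Primes`: for a pro-`Σ` `Δ` with `Σ ≠ Primes` it forces `m = 0` (HONEST SCOPE of
`thm26ii_of_starCondition_of_isProSet`).  This DEF-BEARING file (two definitions, no instance, no
notation, nothing asserted; abc-iut-L4-lead RULING #7j «THM26II-SIGMA-STAR») supplies the print-shaped
input for a general construction-data prime set `Σ`:

* `HatZSigmaPow S m` — the free pro-`Σ` abelian group `Ẑ_Σ^m`, MODELLED as `∏_{l ∈ Σ prime} ℤ_l^m`
  (the group `Q` with `Q ⊗ ℤ_l = Q_l` of rank `m` for `l ∈ Σ` and `= 0` for `l ∉ Σ`), written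
  multiplicatively like the tree's `HatZPow`;
* `FundamentalExtension.SigmaStarCondition S` — **(∗)_Σ**: for every open `Π″ ⊆ Π`,
  `Δ″/R ≅ Ẑ_Σ^m` for some `m` ((∗) with `Ẑ` replaced by `Ẑ_Σ`).  A HYPOTHESIS predicate (a reading of
  the displayed sentence of the proof of Thm 2.6 (ii), where it is a consequence of
  `Δ^{ab-t} ⊗ ℤ_l ⥲ T_l(A)`, `l ∈ Σ`), never asserted here;

and PROVES the three facts about the model that the general-target rank identity
(`AbsAnabCoinvariantRankGeneralProofs.lean`) consumes — `HatZSigmaPow.exists_proj` (the `l`-th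
projection `Ẑ_Σ^m → ℤ_l^m`, `l ∈ Σ`), `HatZSigmaPow.additive_eq_zero_of_apply_single` (a continuous
additive `ℚ_l`-valued function on `Ẑ_Σ^m` vanishing at the `m` coordinate vectors vanishes, ANY prime
`l`: `l`-adic approximation in the `l`-th factor, `l`-divisibility of `ℤ_{l′}`, `l′ ≠ l`, in the others
— no Chinese-remainder density needed), `HatZSigmaPow.additive_eq_zero_of_not_mem` (for `l ∉ Σ` it
vanishes outright) — and the sanity instance `FundamentalExtension.sigmaStarCondition_of_geom_eq_bot`
((∗)_Σ holds with `m = 0` when `Δ = 1`).  The closers — the rank identity for every open `Π″` and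
[AbsTopI] Thm 2.6 (ii) AS TYPED from (∗)_Σ with `m` free — are the proof-only companion
`AbsTopIThm26iiSigmaStarProofs.lean`.

Deliberately NOT here: the comparison `StarCondition ↔ SigmaStarCondition Primes` (needs
`Ẑ^m ≅ ∏_l ℤ_l^m` for Mathlib's profinite completion of `ℤ^m`; the tree has the rank-one case only,
`isFreeProcyclic_iff_nonempty_continuousMulEquiv_padicProd`) — TODO(general form).

HONEST FRAMING: [AbsTopI] and [AbsAnab] are refereed, undisputed papers; classical profinite group
theory; (∗)_Σ is a typed INPUT (geometric in print), never asserted; nothing here bears on [IUTchIII]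
Cor. 3.12; typed ≠ proved elsewhere.
-/

noncomputable section

open Topology Filter

universe u v

namespace Literature.AnabelianGeometry.AbsoluteAnabelian

/-! ### The model `Ẑ_Σ^m = ∏_{l ∈ Σ} ℤ_l^m` -/

/-- **`Ẑ_Σ^m`**, the free pro-`Σ` abelian group of rank `m` (the shape of [AbsTopI]'s `Q = T(A)/G`,
"the maximal torsion-free quotient on which `G` acts trivially", a module over `Ẑ_Σ = ∏_{l ∈ Σ} ℤ_l`
with "`Q_l := Q ⊗ ℤ_l`" of `ℤ_l`-rank independent of `l ∈ Σ`), MODELLED concretely and written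
multiplicatively: `m`-tuples of elements of `∏_{l prime, l ∈ Σ} ℤ_l`.  For `Σ ⊇ Primes` this is
`∏_l ℤ_l^m ≅ Ẑ^m`. [cite: MochizukiAbsTopI2012, Thm 2.6 (ii) proof p.23] -/
abbrev HatZSigmaPow (S : Set ℕ) (m : ℕ) : Type :=
  Multiplicative (Fin m → ∀ l : {l : ℕ // l.Prime ∧ l ∈ S}, @PadicInt l.1 ⟨l.2.1⟩)

namespace HatZSigmaPow

variable {S : Set ℕ} {m : ℕ}

/-- **The `l`-th projection `Ẑ_Σ^m → ℤ_l^m`** for a prime `l ∈ Σ` ("`Q ↠ Q_l = Q ⊗ ℤ_l`"), a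
continuous homomorphism reading off the `l`-coordinates. [cite: MochizukiAbsTopI2012, Thm 2.6 (ii) proof p.23] -/
theorem exists_proj (l : ℕ) [hl : Fact l.Prime] (hlS : l ∈ S) :
    ∃ L : HatZSigmaPow S m →ₜ* Multiplicative (Fin m → ℤ_[l]),
      ∀ (x : HatZSigmaPow S m) (j : Fin m),
        Multiplicative.toAdd (L x) j = Multiplicative.toAdd x j ⟨l, hl.1, hlS⟩ :=
  ⟨{ toFun := fun x => Multiplicative.ofAdd fun j => Multiplicative.toAdd x j ⟨l, hl.1, hlS⟩
     map_one' := rfl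
     map_mul' := fun _ _ => rfl
     continuous_toFun := continuous_ofAdd.comp (continuous_pi fun j =>
       (continuous_apply _).comp ((continuous_apply j).comp continuous_toAdd)) },
    fun _ _ => rfl⟩

/-- A continuous additive `ℚ_l`-valued function `g` on a compact group takes the value `0` at every
element `x` which, for every `n`, factors as `x = a · w^{lⁿ}` with `g(a) = 0`: indeed
`‖g(x)‖ = ‖lⁿ · g(w)‖ ≤ l⁻ⁿ · sup ‖g‖ → 0`. [folklore] -/
private theorem additive_apply_eq_zero_of_pow_divisible {T : Type v} [Group T] [TopologicalSpace T]
    [CompactSpace T] (l : ℕ) [hl : Fact l.Prime] (g : T → ℚ_[l]) (hg : Continuous g)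
    (hadd : ∀ x y, g (x * y) = g x + g y) (x : T)
    (hdiv : ∀ n : ℕ, ∃ a w : T, x = a * w ^ (l ^ n) ∧ g a = 0) : g x = 0 := by
  have g1 : g 1 = 0 := by
    have h := hadd 1 1
    rw [mul_one] at h
    have h' : g 1 + g 1 = g 1 + 0 := by rw [add_zero]; exact h.symm
    exact add_left_cancel h'
  have gpow : ∀ (y : T) (N : ℕ), g (y ^ N) = N * g y := by
    intro y N
    induction N with
    | zero => simp [g1]
    | succ n ih => rw [pow_succ, hadd, ih]; push_cast; ring
  obtain ⟨C, hC⟩ := (isCompact_range hg).isBounded.exists_norm_le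
  have hbound : ∀ n : ℕ, ‖g x‖ ≤ ((l : ℝ)⁻¹) ^ n * C := by
    intro n
    obtain ⟨a, w, hx, ha⟩ := hdiv n
    rw [hx, hadd, ha, zero_add, gpow, norm_mul]
    have h1 : ‖((l ^ n : ℕ) : ℚ_[l])‖ = ((l : ℝ)⁻¹) ^ n := by
      rw [Nat.cast_pow, norm_pow, Padic.norm_p]
    rw [h1]
    exact mul_le_mul_of_nonneg_left (hC _ ⟨w, rfl⟩)
      (pow_nonneg (inv_nonneg.mpr (Nat.cast_nonneg _)) n)
  have hlt : (l : ℝ)⁻¹ < 1 := inv_lt_one_of_one_lt₀ (by exact_mod_cast hl.1.one_lt)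
  have hnn : 0 ≤ (l : ℝ)⁻¹ := inv_nonneg.mpr (Nat.cast_nonneg _)
  have htend : Tendsto (fun n : ℕ => ((l : ℝ)⁻¹) ^ n * C) atTop (𝓝 0) := by
    have h := (tendsto_pow_atTop_nhds_zero_of_lt_one hnn hlt).mul_const C
    simpa using h
  have hle : ‖g x‖ ≤ 0 := ge_of_tendsto' htend hbound
  exact norm_le_zero_iff.mp hle

/-- In `ℤ_p`, every element is divisible by `lⁿ` for a prime `l ≠ p` (`l` is a unit). [folklore] -/
private theorem exists_eq_pow_mul_of_ne (p : ℕ) [hp : Fact p.Prime] {l : ℕ} (hl : l.Prime)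
    (hpl : p ≠ l) (n : ℕ) (y : ℤ_[p]) : ∃ w : ℤ_[p], y = (l : ℤ_[p]) ^ n * w := by
  have hu : IsUnit ((l : ℤ_[p]) ^ n) := by
    refine IsUnit.pow n ?_
    rw [PadicInt.isUnit_iff]
    have hle := PadicInt.norm_le_one ((l : ℤ) : ℤ_[p])
    have hnlt : ¬ ‖((l : ℤ) : ℤ_[p])‖ < 1 := by
      rw [PadicInt.norm_int_lt_one_iff_dvd]
      intro h
      have h' : p ∣ l := by exact_mod_cast h
      exact hpl ((Nat.prime_dvd_prime_iff_eq hp.1 hl).mp h')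
    have h1 : ‖((l : ℤ) : ℤ_[p])‖ = 1 := le_antisymm hle (not_lt.mp hnlt)
    simpa using h1
  obtain ⟨c, hc⟩ := hu
  exact ⟨(↑c⁻¹ : ℤ_[p]) * y, by rw [← hc, ← mul_assoc, Units.mul_inv, one_mul]⟩

/-- For `x ∈ Ẑ_Σ^m`, a prime `l` and `n ∈ ℕ`: `x = a · w^{lⁿ}` where `a` has NATURAL-NUMBER coordinates
`a_j`, the same in every factor `ℤ_{l′}` (`l`-adic approximation of the `l`-th coordinates when
`l ∈ Σ`; in the factors `l′ ≠ l` everything is `lⁿ`-divisible). [folklore] -/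
private theorem exists_decomp (l : ℕ) [hl : Fact l.Prime] (x : HatZSigmaPow S m) (n : ℕ) :
    ∃ (a : Fin m → ℕ) (w : HatZSigmaPow S m),
      x = Multiplicative.ofAdd (fun (j : Fin m) (l' : {l : ℕ // l.Prime ∧ l ∈ S}) =>
            ((a j : ℕ) : @PadicInt l'.1 ⟨l'.2.1⟩)) * w ^ (l ^ n) := by
  classical
  -- the integer parts of the `l`-th coordinates (if `l ∈ Σ`)
  let a : Fin m → ℕ := fun j =>
    if hlS : l ∈ S then (Multiplicative.toAdd x j ⟨l, hl.1, hlS⟩).appr n else 0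
  have hcoord : ∀ (j : Fin m) (l' : {l : ℕ // l.Prime ∧ l ∈ S}),
      ∃ w : @PadicInt l'.1 ⟨l'.2.1⟩,
        Multiplicative.toAdd x j l' = ((a j : ℕ) : @PadicInt l'.1 ⟨l'.2.1⟩) +
          ((l : @PadicInt l'.1 ⟨l'.2.1⟩) ^ n) * w := by
    intro j l'
    haveI : Fact (l'.1).Prime := ⟨l'.2.1⟩
    by_cases h : l'.1 = l
    · -- the `l`-th factor: `l`-adic approximation
      have hlS : l ∈ S := h ▸ l'.2.2
      have hl' : l' = ⟨l, hl.1, hlS⟩ := Subtype.ext h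
      subst hl'
      have ha : a j = (Multiplicative.toAdd x j ⟨l, hl.1, hlS⟩).appr n := dif_pos hlS
      have hspec := PadicInt.appr_spec n (Multiplicative.toAdd x j ⟨l, hl.1, hlS⟩)
      rw [Ideal.mem_span_singleton'] at hspec
      obtain ⟨w, hw⟩ := hspec
      refine ⟨w, ?_⟩
      rw [ha, mul_comm, hw, add_sub_cancel]
    · -- a factor `l′ ≠ l`: `lⁿ` is a unit
      obtain ⟨w, hw⟩ := exists_eq_pow_mul_of_ne l'.1 hl.1 h n
        (Multiplicative.toAdd x j l' - ((a j : ℕ) : @PadicInt l'.1 ⟨l'.2.1⟩))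
      exact ⟨w, by rw [← hw, add_sub_cancel]⟩
  choose w hw using hcoord
  refine ⟨a, Multiplicative.ofAdd w, ?_⟩
  apply Multiplicative.toAdd.injective
  funext j l'
  rw [toAdd_mul, toAdd_pow, toAdd_ofAdd, toAdd_ofAdd, Pi.add_apply, Pi.add_apply, Pi.smul_apply,
    Pi.smul_apply, hw j l', nsmul_eq_mul, Nat.cast_pow]

/-- **A continuous additive `ℚ_l`-valued function on `Ẑ_Σ^m` is determined by its values at the `m`
coordinate vectors** `e_k = (δ_{jk})_j` (for ANY prime `l`): if it vanishes at every `e_k`, it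
vanishes.  This is the finiteness "`dim_{ℚ_l}(Q_l ⊗ ℚ_l) = m`" in the form the rank identity consumes.
[cite: MochizukiAbsTopI2012, Thm 2.6 (ii) proof p.23] -/
theorem additive_eq_zero_of_apply_single (l : ℕ) [hl : Fact l.Prime]
    (g : HatZSigmaPow S m → ℚ_[l]) (hg : Continuous g) (hadd : ∀ x y, g (x * y) = g x + g y)
    (hvan : ∀ k : Fin m, g (Multiplicative.ofAdd
      (Pi.single k (1 : ∀ l' : {l : ℕ // l.Prime ∧ l ∈ S}, @PadicInt l'.1 ⟨l'.2.1⟩))) = 0)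
    (x : HatZSigmaPow S m) : g x = 0 := by
  classical
  have g1 : g 1 = 0 := by
    have h := hadd 1 1
    rw [mul_one] at h
    have h' : g 1 + g 1 = g 1 + 0 := by rw [add_zero]; exact h.symm
    exact add_left_cancel h'
  have gpow : ∀ (y : HatZSigmaPow S m) (N : ℕ), g (y ^ N) = N * g y := by
    intro y N
    induction N with
    | zero => simp [g1]
    | succ n ih => rw [pow_succ, hadd, ih]; push_cast; ring
  -- `g` of a finite product is the sum
  have gprod : ∀ f : Fin m → HatZSigmaPow S m, g (∏ j, f j) = ∑ j, g (f j) := by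
    intro f
    let G : HatZSigmaPow S m →* Multiplicative ℚ_[l] :=
      { toFun := fun y => Multiplicative.ofAdd (g y)
        map_one' := by rw [g1]; rfl
        map_mul' := fun y z => by rw [hadd, ofAdd_add] }
    have h := map_prod G f Finset.univ
    apply Multiplicative.ofAdd.injective
    rw [ofAdd_sum]
    exact h
  refine additive_apply_eq_zero_of_pow_divisible l g hg hadd x fun n => ?_
  obtain ⟨a, w, hx⟩ := exists_decomp (S := S) (m := m) l x n
  refine ⟨_, w, hx, ?_⟩
  -- `a = ∏_j e_j^{a_j}`
  have ha : (Multiplicative.ofAdd fun (j : Fin m) (l' : {l : ℕ // l.Prime ∧ l ∈ S}) =>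
      ((a j : ℕ) : @PadicInt l'.1 ⟨l'.2.1⟩)) =
      ∏ j : Fin m, (Multiplicative.ofAdd
        (Pi.single j (1 : ∀ l' : {l : ℕ // l.Prime ∧ l ∈ S}, @PadicInt l'.1 ⟨l'.2.1⟩))) ^ (a j) := by
    have h1 : (fun (j : Fin m) (l' : {l : ℕ // l.Prime ∧ l ∈ S}) =>
        ((a j : ℕ) : @PadicInt l'.1 ⟨l'.2.1⟩)) =
        ∑ j : Fin m, (a j) • Pi.single j
          (1 : ∀ l' : {l : ℕ // l.Prime ∧ l ∈ S}, @PadicInt l'.1 ⟨l'.2.1⟩) := by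
      rw [← Finset.univ_sum_single (fun (j : Fin m) (l' : {l : ℕ // l.Prime ∧ l ∈ S}) =>
        ((a j : ℕ) : @PadicInt l'.1 ⟨l'.2.1⟩))]
      refine Finset.sum_congr rfl fun j _ => ?_
      rw [← Pi.single_smul]
      congr 1
      funext l'
      simp
    rw [h1, ofAdd_sum]
    refine Finset.prod_congr rfl fun j _ => ?_
    rw [ofAdd_nsmul]
  rw [ha, gprod]
  refine Finset.sum_eq_zero fun j _ => ?_
  rw [gpow, hvan j, mul_zero]

/-- **For a prime `l ∉ Σ`, `Ẑ_Σ^m` has no non-zero continuous additive `ℚ_l`-valued function** (it is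
pro-`Σ`: every element is `lⁿ`-divisible for all `n`) — the vanishing "`Q ⊗ ℤ_l = 0`, `l ∉ Σ`" behind
"`δ¹_l(Π) = δ¹_l(G)` for `l ∉ Σ`". [cite: MochizukiAbsTopI2012, Thm 2.6 (ii) proof p.23] -/
theorem additive_eq_zero_of_not_mem (l : ℕ) [hl : Fact l.Prime] (hlS : l ∉ S)
    (g : HatZSigmaPow S m → ℚ_[l]) (hg : Continuous g) (hadd : ∀ x y, g (x * y) = g x + g y)
    (x : HatZSigmaPow S m) : g x = 0 := by
  classical
  have g1 : g 1 = 0 := by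
    have h := hadd 1 1
    rw [mul_one] at h
    have h' : g 1 + g 1 = g 1 + 0 := by rw [add_zero]; exact h.symm
    exact add_left_cancel h'
  refine additive_apply_eq_zero_of_pow_divisible l g hg hadd x fun n => ?_
  have hcoord : ∀ (j : Fin m) (l' : {l : ℕ // l.Prime ∧ l ∈ S}),
      ∃ w : @PadicInt l'.1 ⟨l'.2.1⟩,
        Multiplicative.toAdd x j l' = ((l : @PadicInt l'.1 ⟨l'.2.1⟩) ^ n) * w := by
    intro j l'
    haveI : Fact (l'.1).Prime := ⟨l'.2.1⟩
    have h : l'.1 ≠ l := fun h => hlS (h ▸ l'.2.2)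
    exact exists_eq_pow_mul_of_ne l'.1 hl.1 h n (Multiplicative.toAdd x j l')
  choose w hw using hcoord
  refine ⟨1, Multiplicative.ofAdd w, ?_, g1⟩
  apply Multiplicative.toAdd.injective
  funext j l'
  rw [one_mul, toAdd_pow, toAdd_ofAdd, Pi.smul_apply, Pi.smul_apply, hw j l', nsmul_eq_mul,
    Nat.cast_pow]

end HatZSigmaPow

/-! ### Condition (∗)_Σ -/

namespace FundamentalExtension

variable (E : FundamentalExtension.{u})

/-- **Condition (∗)_Σ** — [AbsAnab] Lemma 1.1.4 (ii) (∗) with `Ẑ` replaced by `Ẑ_Σ`, the shape of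
[AbsTopI] Thm 2.6 (ii)'s "`T_l(A)/G`, the maximal torsion-free quotient on which `G` acts trivially
[…] `Q_l := Q ⊗ ℤ_l` […] the `ℤ_l`-ranks of `R_l`, `Q_l` are independent of `l ∈ Σ`" for an extension
whose `Δ` is the maximal pro-`Σ` quotient of a geometric fundamental group: for every open subgroup
`Π″ ⊆ Π`, with `Δ″ := Δ ∩ Π″` and `R := coinvRadical Π″` (so that `Δ″/R` is the maximal torsion-free
quotient of `(Δ″)^{ab}` with trivial `Π″`-action), `Δ″/R ≅ Ẑ_Σ^m` for some `m` — typed as a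
continuous surjection `Δ″ ↠ Ẑ_Σ^m` with kernel `R`.  A HYPOTHESIS predicate (construction-data
reading), never asserted. [cite: MochizukiAbsTopI2012, Thm 2.6 (ii) proof p.23] -/
def SigmaStarCondition (S : Set ℕ) : Prop :=
  ∀ (P : Subgroup E.arith), IsOpen (P : Set E.arith) →
    ∃ (m : ℕ) (q : ↥(E.geom ⊓ P) →ₜ* HatZSigmaPow S m), Function.Surjective q ∧
      ∀ x : ↥(E.geom ⊓ P), q x = 1 ↔ (x : E.arith) ∈ E.coinvRadical P

/-! ### Sanity: (∗)_Σ at `Δ = 1` -/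

/-- **Sanity**: an extension with `Δ = 1` satisfies (∗)_Σ for every `Σ`, with `m = 0` (`Δ″ = 1`,
`Ẑ_Σ^0 = 1`).  (The predicate is thus satisfiable; that it does not force `m = 0` is the point of the
model `Ẑ_Σ^m`, cf. `HatZSigmaPow.exists_proj`.) [cite: MochizukiAbsTopI2012, Thm 2.6 (ii) proof p.23] -/
theorem sigmaStarCondition_of_geom_eq_bot (h : E.geom = ⊥) (S : Set ℕ) : E.SigmaStarCondition S := by
  intro P _
  refine ⟨0, ⟨1, continuous_const⟩, fun t => ⟨1, ?_⟩, fun x => ⟨fun _ => ?_, fun _ => ?_⟩⟩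
  · apply Multiplicative.toAdd.injective
    funext j
    exact Fin.elim0 j
  · have hx : (x : E.arith) = 1 := Subgroup.mem_bot.mp (h.le (Subgroup.mem_inf.mp x.2).1)
    rw [hx]
    exact Subgroup.one_mem _
  · rfl

end FundamentalExtension

end Literature.AnabelianGeometry.AbsoluteAnabelian

end
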